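import Summits.Parity.GeneralizedHardyLittlewood.Theorems.PrimeLevelFamEdgeMomentsBeyondDiagonalDictionaryAtOneBounds
import Literature.NumberTheory.Sieve.QuadraticRootsPrimeModuliDFISieveEstimates
import HarnessLib

/-!
# Route `PrimeLevelFamEdge`, crux K_A `MomentsBeyondDiagonal` (stmt-Parity-20007), line «petersson_layers» v4:
# the FAR PETERSSON LAYERS — kernel-level Weil bounds WITH the gcd (toward `stub_farP : SubFar rhoP`)

The far-layer piece `SubFar ρ` (deck 21b/21c) asks that `Σ_{q̂^{ρ} < r ≤ q⁸} K_r` be `O(q̂ log⁻³ q̂)`; at the Weil cut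
`ρ_W = 4Δ' − 3/2` this is a fixed-pair statement (deck 21b §5b, THE COUNT), but only if Weil's bound is used with its
gcd `((a, b, qr))^{1/2}` honestly: the shortcut `√(a,b)·√(ab) ≤ (ab)^{3/4}` of `…DictionaryAtOneTruncation` (enough for the
tail `r > q⁸`) loses `(ab)^{1/4} ≈ q̂` against a margin of `q̂^{1/4}`. This file supplies the gcd-honest kernel bounds:
* `norm_petKloostermanTerm_le_gcd_rpow`: `‖r⁻¹S(a,b;qr)J₁(4π√(ab)/(qr))‖ ≤ 4πC √(a,qr) √(ab) q^{−1/2} r^{−(3/2−ε)}`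
  (Weil's bound — the tree's theorem `weil_kloosterman_bound_holds` — with `(a,b,qr) ≤ (a,qr)`, `τ(qr) ≤ 2τ(r) ≤ 2C r^ε`,
  `|J₁(x)| ≤ x/2`);
* `gcd_mul_div_sq_le`: for `a = m n/d²` (`d ∣ (m,n)`), `q` prime, `q ∤ m`: `(a, qr) ≤ (n, q)·(mn, r)`;
* `sum_rpow_sqrt_gcd_le`: the gcd sum `Σ_{R < r ≤ R₂} r^{−149/100} √(N, r) ≤ ζ_ℕ(101/100) τ(N) (R+1)^{−12/25}`;
* `sum_norm_layerKernel_le`: for the pairs `a = m₁n₁/d₁²`, `b = m₂n₂/d₂²` of the spectral sum,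
  `Σ_{R < r ≤ R₂} ‖K_r-kernel(a,b)‖ ≤ 8π²Cζ · q^{−3/2} (R+1)^{−12/25} · √(n₁,q) τ(m₁)τ(n₁) √(m₁n₁m₂n₂)`
  (`τ(m₁n₁) ≤ τ(m₁)τ(n₁)` is the tree's `DFI1995.card_divisors_mul_le`).
Proof only (helper toward `stub_farP`); nothing about `stub_core`/`stub_rung`/`stub_band`; K_A NOT proved; nothing about
Landau–Siegel zeros.
-/

noncomputable section

open scoped Real Nat
open Complex Finset
open Literature.NumberTheory.LFunctions

namespace Summit.Parity.GeneralizedHardyLittlewood.Theorems.MomentsBeyondDiagonal.FarLayers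

open Summit.Parity.GeneralizedHardyLittlewood.Theorems.PrimeLevelFamEdgeIdeaDeltas.PeterssonLayers

/-! ## §1. One Kloosterman–Bessel term, Weil's bound with the gcd against the modulus -/

/-- **One Kloosterman–Bessel layer term, gcd-honest**: for `q` prime, `a, b : ℕ`, a divisor bound `τ(r) ≤ C r^ε` and
`r ≥ 1`: `‖r⁻¹ S(a,b;qr) J₁(4π√(ab)/(qr))‖ ≤ 4πC √((a,qr)) √(ab) q^{−1/2} r^{−(3/2−ε)}` (Weil's bound
`|S(a,b;c)| ≤ (a,b,c)^{1/2} c^{1/2} τ(c)` — the tree's theorem `weil_kloosterman_bound_holds` — with `(a,b,qr) ≤ (a,qr)`,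
`τ(qr) ≤ 2τ(r)`, `|J₁(x)| ≤ x/2`). [cite: Iwaniec2002, §2.5 (2.25); KowalskiMichel2000, §2.4.2 p. 312 (23)] -/
theorem norm_petKloostermanTerm_le_gcd_rpow {q : ℕ} [NeZero q] (hq : q.Prime) (a b : ℕ)
    {ε C : ℝ} (hC : ∀ r : ℕ, ((r.divisors.card : ℕ) : ℝ) ≤ C * (r : ℝ) ^ ε) (r : ℕ) (hr : r ≠ 0) :
    ‖KowalskiMichel2000.petKloostermanTerm q a b r‖ ≤
      4 * π * C * Real.sqrt ((Nat.gcd a (q * r) : ℕ) : ℝ) * Real.sqrt ((a : ℝ) * b) *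
        (q : ℝ) ^ (-(1 / 2 : ℝ)) * (r : ℝ) ^ (-(3 / 2 - ε)) := by
  haveI : NeZero (q * r) := ⟨mul_ne_zero hq.ne_zero hr⟩
  have hq0 : (0 : ℝ) < q := by exact_mod_cast hq.pos
  have hr0 : (0 : ℝ) < r := by exact_mod_cast Nat.pos_of_ne_zero hr
  have hqr0 : 0 < q * r := Nat.pos_of_ne_zero (mul_ne_zero hq.ne_zero hr)
  have hC0 : 0 ≤ C := by
    have h := hC 1
    simp at h
    linarith
  set g : ℕ := a.gcd b with hgdef
  have hWeil : ‖kloostermanSum (q * r) (a : ZMod (q * r)) (b : ZMod (q * r))‖ ≤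
      Real.sqrt (Nat.gcd g (q * r) : ℕ) * Real.sqrt ((q : ℝ) * r) *
        (((q * r).divisors.card : ℕ) : ℝ) := by
    have h := weil_kloosterman_bound_holds (q * r) (a : ℤ) (b : ℤ)
    simp only [Int.cast_natCast, Int.natAbs_natCast, Nat.cast_mul] at h
    exact h
  -- `(a, b, qr) ≤ (a, qr)`
  have hgcd : Real.sqrt (Nat.gcd g (q * r) : ℕ) ≤ Real.sqrt ((Nat.gcd a (q * r) : ℕ) : ℝ) := by
    refine Real.sqrt_le_sqrt ?_
    have hdvd : Nat.gcd g (q * r) ∣ Nat.gcd a (q * r) :=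
      Nat.gcd_dvd_gcd_of_dvd_left (q * r) (Nat.gcd_dvd_left a b)
    exact_mod_cast Nat.le_of_dvd (Nat.gcd_pos_of_pos_right a hqr0) hdvd
  have hτ : (((q * r).divisors.card : ℕ) : ℝ) ≤ 2 * C * (r : ℝ) ^ ε := by
    calc (((q * r).divisors.card : ℕ) : ℝ) ≤ ((2 * r.divisors.card : ℕ) : ℝ) := by
          exact_mod_cast KowalskiMichel2000.card_divisors_prime_mul_le hq hr
      _ = 2 * ((r.divisors.card : ℕ) : ℝ) := by push_cast; ring
      _ ≤ 2 * (C * (r : ℝ) ^ ε) := by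
          gcongr
          exact hC r
      _ = 2 * C * (r : ℝ) ^ ε := by ring
  have hx0 : 0 ≤ 4 * π * Real.sqrt ((a : ℝ) * b) / ((q : ℝ) * r) := by positivity
  have hJ : |Literature.Analysis.FunctionSpaces.besselJ 1 (4 * π * Real.sqrt ((a : ℝ) * b) / ((q : ℝ) * r))| ≤
      (4 * π * Real.sqrt ((a : ℝ) * b) / ((q : ℝ) * r)) / 2 :=
    Literature.Analysis.FunctionSpaces.abs_besselJ_one_le_half_mul hx0
  rw [KowalskiMichel2000.petKloostermanTerm_of_ne_zero q a b hr]
  rw [norm_mul, norm_mul, norm_inv, Complex.norm_natCast, Complex.norm_real, Real.norm_eq_abs]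
  calc (r : ℝ)⁻¹ * ‖kloostermanSum (q * r) (a : ZMod (q * r)) (b : ZMod (q * r))‖ *
        |Literature.Analysis.FunctionSpaces.besselJ 1 (4 * π * Real.sqrt ((a : ℝ) * b) / ((q : ℝ) * r))|
      ≤ (r : ℝ)⁻¹ * (Real.sqrt ((Nat.gcd a (q * r) : ℕ) : ℝ) * Real.sqrt ((q : ℝ) * r) * (2 * C * (r : ℝ) ^ ε)) *
          ((4 * π * Real.sqrt ((a : ℝ) * b) / ((q : ℝ) * r)) / 2) := by
        gcongr
        calc ‖kloostermanSum (q * r) (a : ZMod (q * r)) (b : ZMod (q * r))‖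
            ≤ Real.sqrt (Nat.gcd g (q * r) : ℕ) * Real.sqrt ((q : ℝ) * r) *
                (((q * r).divisors.card : ℕ) : ℝ) := hWeil
          _ ≤ Real.sqrt ((Nat.gcd a (q * r) : ℕ) : ℝ) * Real.sqrt ((q : ℝ) * r) * (2 * C * (r : ℝ) ^ ε) := by
              gcongr
    _ = 4 * π * C * Real.sqrt ((Nat.gcd a (q * r) : ℕ) : ℝ) * Real.sqrt ((a : ℝ) * b) *
          (q : ℝ) ^ (-(1 / 2 : ℝ)) * (r : ℝ) ^ (-(3 / 2 - ε)) := by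
        rw [Real.sqrt_eq_rpow ((q : ℝ) * r), Real.mul_rpow hq0.le hr0.le]
        have er : (r : ℝ)⁻¹ * (r : ℝ) ^ (1 / 2 : ℝ) * (r : ℝ) ^ ε / (r : ℝ) =
            (r : ℝ) ^ (-(3 / 2 - ε)) := by
          rw [← Real.rpow_neg_one, div_eq_mul_inv, ← Real.rpow_neg_one, ← Real.rpow_add hr0,
            ← Real.rpow_add hr0, ← Real.rpow_add hr0]
          congr 1
          ring
        have eq' : (q : ℝ) ^ (1 / 2 : ℝ) / (q : ℝ) = (q : ℝ) ^ (-(1 / 2 : ℝ)) := by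
          rw [div_eq_mul_inv, ← Real.rpow_neg_one, ← Real.rpow_add hq0]
          congr 1
          ring
        calc (r : ℝ)⁻¹ * (Real.sqrt ((Nat.gcd a (q * r) : ℕ) : ℝ) * ((q : ℝ) ^ (1 / 2 : ℝ) * (r : ℝ) ^ (1 / 2 : ℝ)) *
              (2 * C * (r : ℝ) ^ ε)) *
              ((4 * π * Real.sqrt ((a : ℝ) * b) / ((q : ℝ) * r)) / 2)
            = 4 * π * C * Real.sqrt ((Nat.gcd a (q * r) : ℕ) : ℝ) * Real.sqrt ((a : ℝ) * b) *
                ((q : ℝ) ^ (1 / 2 : ℝ) / (q : ℝ)) *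
                ((r : ℝ)⁻¹ * (r : ℝ) ^ (1 / 2 : ℝ) * (r : ℝ) ^ ε / (r : ℝ)) := by
              field_simp
          _ = _ := by rw [er, eq']

/-! ## §2. The gcd against `qr` for the pairs of the spectral sum -/

/-- For `d ∣ (m, n)`: `m n / d² ∣ m n` (`d² ∣ m n`). -/
theorem mul_div_sq_dvd {m n d : ℕ} (hd : d ∈ (Nat.gcd m n).divisors) : m * n / d ^ 2 ∣ m * n := by
  have hd' : d ∣ Nat.gcd m n := Nat.dvd_of_mem_divisors hd
  have h1 : d ∣ m := hd'.trans (Nat.gcd_dvd_left m n)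
  have h2 : d ∣ n := hd'.trans (Nat.gcd_dvd_right m n)
  have hsq : d ^ 2 ∣ m * n := by rw [sq]; exact Nat.mul_dvd_mul h1 h2
  exact Nat.div_dvd_of_dvd hsq

/-- **The gcd against the Petersson modulus splits**: for `q` prime, `q ∤ m`, `n ≠ 0` and `a ∣ m n`:
`(a, qr) ≤ (n, q) · (mn, r)` (`(a,qr) ∣ (mn,qr) ∣ (mn,q)(mn,r)` and `(mn,q) = (n,q)`). -/
theorem gcd_le_of_dvd_mul {q m n a r : ℕ} (hq : q.Prime) (hqm : ¬ q ∣ m) (hn : n ≠ 0) (hr : r ≠ 0)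
    (ha : a ∣ m * n) : Nat.gcd a (q * r) ≤ Nat.gcd n q * Nat.gcd (m * n) r := by
  have h1 : Nat.gcd a (q * r) ∣ Nat.gcd (m * n) (q * r) := Nat.gcd_dvd_gcd_of_dvd_left (q * r) ha
  have h2 : Nat.gcd (m * n) (q * r) ∣ Nat.gcd (m * n) q * Nat.gcd (m * n) r :=
    Nat.gcd_mul_right_dvd_mul_gcd _ _ _
  have hcop : Nat.Coprime m q := (Nat.coprime_comm.mp ((Nat.Prime.coprime_iff_not_dvd hq).mpr hqm))
  have h3 : Nat.gcd (m * n) q = Nat.gcd n q := Nat.Coprime.gcd_mul_left_cancel n hcop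
  rw [h3] at h2
  have hpos : 0 < Nat.gcd n q * Nat.gcd (m * n) r :=
    Nat.mul_pos (Nat.gcd_pos_of_pos_left q (Nat.pos_of_ne_zero hn))
      (Nat.gcd_pos_of_pos_right _ (Nat.pos_of_ne_zero hr))
  exact Nat.le_of_dvd hpos (h1.trans h2)

/-- The pairs of the spectral sum: for `d ∣ (m, n)`, `q` prime, `q ∤ m`, `n ≠ 0`, `r ≠ 0`:
`(m n/d², qr) ≤ (n, q)·(mn, r)`. -/
theorem gcd_mul_div_sq_le {q m n d r : ℕ} (hq : q.Prime) (hqm : ¬ q ∣ m) (hn : n ≠ 0) (hr : r ≠ 0)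
    (hd : d ∈ (Nat.gcd m n).divisors) :
    Nat.gcd (m * n / d ^ 2) (q * r) ≤ Nat.gcd n q * Nat.gcd (m * n) r :=
  gcd_le_of_dvd_mul hq hqm hn hr (mul_div_sq_dvd hd)

/-! ## §3. The gcd sum over the layers -/

/-- `ζ_ℕ(101/100) = Σ_{k ≥ 0} k^{−101/100}` (the `k = 0` term is `0`), the constant of the gcd sum. -/
theorem summable_rpow_101 : Summable (fun k : ℕ ↦ ((k : ℝ)) ^ (-(101 / 100 : ℝ))) :=
  Real.summable_nat_rpow.mpr (by norm_num)

/-- `√((N, r)) ≤ Σ_{g ∣ N} [g ∣ r] √g` for `N ≠ 0` (the gcd is one of the common divisors). -/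
theorem sqrt_gcd_le_sum_divisors {N : ℕ} (hN : N ≠ 0) (r : ℕ) :
    Real.sqrt ((Nat.gcd N r : ℕ) : ℝ) ≤ ∑ g ∈ N.divisors, (if g ∣ r then Real.sqrt (g : ℝ) else 0) := by
  have hmem : Nat.gcd N r ∈ N.divisors := Nat.mem_divisors.mpr ⟨Nat.gcd_dvd_left N r, hN⟩
  have hle := Finset.single_le_sum (f := fun g ↦ (if g ∣ r then Real.sqrt (g : ℝ) else 0))
    (fun g _ ↦ by positivity) hmem
  simp only [Nat.gcd_dvd_right, if_true] at hle
  exact hle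

/-- The multiples of `g ≥ 1` in `(R, R₂]`: `Σ_{R < r ≤ R₂, g ∣ r} r^{−101/100} ≤ g^{−101/100} ζ_ℕ(101/100)`. -/
theorem sum_filter_dvd_rpow_le {g : ℕ} (hg : g ≠ 0) (R R₂ : ℕ) :
    ∑ r ∈ (Icc (R + 1) R₂).filter (fun r ↦ g ∣ r), ((r : ℝ)) ^ (-(101 / 100 : ℝ)) ≤
      ((g : ℝ)) ^ (-(101 / 100 : ℝ)) * ∑' k : ℕ, ((k : ℝ)) ^ (-(101 / 100 : ℝ)) := by
  have hg0 : (0 : ℝ) < g := by exact_mod_cast Nat.pos_of_ne_zero hg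
  set F := (Icc (R + 1) R₂).filter (fun r ↦ g ∣ r) with hF
  -- rewrite each term through `r = g · (r / g)`
  have hterm : ∀ r ∈ F, ((r : ℝ)) ^ (-(101 / 100 : ℝ)) =
      ((g : ℝ)) ^ (-(101 / 100 : ℝ)) * (((r / g : ℕ) : ℝ)) ^ (-(101 / 100 : ℝ)) := by
    intro r hr
    have hdvd : g ∣ r := (Finset.mem_filter.mp hr).2
    have hr' : ((r : ℝ)) = (g : ℝ) * (((r / g : ℕ) : ℝ)) := by
      exact_mod_cast (Nat.mul_div_cancel' hdvd).symm
    rw [hr', Real.mul_rpow hg0.le (Nat.cast_nonneg _)]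
  rw [Finset.sum_congr rfl hterm, ← Finset.mul_sum]
  refine mul_le_mul_of_nonneg_left ?_ (Real.rpow_nonneg hg0.le _)
  -- reindex by `r ↦ r / g` (injective on multiples of `g`) and compare with the full series
  have hinj : Set.InjOn (fun r : ℕ ↦ r / g) F := by
    intro r₁ hr₁ r₂ hr₂ h
    have h₁ : g ∣ r₁ := (Finset.mem_filter.mp hr₁).2
    have h₂ : g ∣ r₂ := (Finset.mem_filter.mp hr₂).2
    have := congrArg (fun k ↦ g * k) h
    simp only at this
    rwa [Nat.mul_div_cancel' h₁, Nat.mul_div_cancel' h₂] at this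
  calc ∑ r ∈ F, (((r / g : ℕ) : ℝ)) ^ (-(101 / 100 : ℝ))
      = ∑ k ∈ F.image (fun r : ℕ ↦ r / g), ((k : ℝ)) ^ (-(101 / 100 : ℝ)) :=
        (Finset.sum_image (f := fun k : ℕ ↦ ((k : ℝ)) ^ (-(101 / 100 : ℝ))) hinj).symm
    _ ≤ ∑' k : ℕ, ((k : ℝ)) ^ (-(101 / 100 : ℝ)) :=
        summable_rpow_101.sum_le_tsum _ (fun k _ ↦ Real.rpow_nonneg (Nat.cast_nonneg _) _)

/-- **The gcd sum over the far layers**: for `N ≥ 1` and all `R, R₂`,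
`Σ_{R < r ≤ R₂} r^{−149/100} √((N, r)) ≤ ζ_ℕ(101/100) · τ(N) · (R+1)^{−12/25}`
(`√(N,r) ≤ Σ_{g∣N, g∣r} √g`, the multiples of `g` contribute `g^{1/2−101/100} ζ ≤ ζ`, and `r^{−12/25} ≤ (R+1)^{−12/25}`). -/
theorem sum_rpow_sqrt_gcd_le {N : ℕ} (hN : N ≠ 0) (R R₂ : ℕ) :
    ∑ r ∈ Icc (R + 1) R₂, ((r : ℝ)) ^ (-(149 / 100 : ℝ)) * Real.sqrt ((Nat.gcd N r : ℕ) : ℝ) ≤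
      (∑' k : ℕ, ((k : ℝ)) ^ (-(101 / 100 : ℝ))) * (N.divisors.card : ℝ) *
        (((R + 1 : ℕ) : ℝ)) ^ (-(12 / 25 : ℝ)) := by
  set Z : ℝ := ∑' k : ℕ, ((k : ℝ)) ^ (-(101 / 100 : ℝ)) with hZ
  have hZ0 : 0 ≤ Z := tsum_nonneg fun k ↦ Real.rpow_nonneg (Nat.cast_nonneg _) _
  have hR0 : (0 : ℝ) < ((R + 1 : ℕ) : ℝ) := by positivity
  set T : ℝ := (((R + 1 : ℕ) : ℝ)) ^ (-(12 / 25 : ℝ)) with hT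
  have hT0 : 0 ≤ T := Real.rpow_nonneg hR0.le _
  -- termwise: `r^{-149/100} √(N,r) ≤ T · r^{-101/100} · Σ_g [g∣r] √g`
  have hpt : ∀ r ∈ Icc (R + 1) R₂, ((r : ℝ)) ^ (-(149 / 100 : ℝ)) * Real.sqrt ((Nat.gcd N r : ℕ) : ℝ) ≤
      T * (((r : ℝ)) ^ (-(101 / 100 : ℝ)) * ∑ g ∈ N.divisors, (if g ∣ r then Real.sqrt (g : ℝ) else 0)) := by
    intro r hr
    have hr' := Finset.mem_Icc.mp hr
    have hr0 : (0 : ℝ) < r := by exact_mod_cast (show 0 < r by omega)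
    have hRr : (((R + 1 : ℕ) : ℝ)) ≤ r := by exact_mod_cast hr'.1
    have hsplit : ((r : ℝ)) ^ (-(149 / 100 : ℝ)) = ((r : ℝ)) ^ (-(12 / 25 : ℝ)) * ((r : ℝ)) ^ (-(101 / 100 : ℝ)) := by
      rw [← Real.rpow_add hr0]; norm_num
    have h1 : ((r : ℝ)) ^ (-(12 / 25 : ℝ)) ≤ T := Real.rpow_le_rpow_of_nonpos hR0 hRr (by norm_num)
    have h2 := sqrt_gcd_le_sum_divisors hN r
    rw [hsplit, mul_assoc]
    exact mul_le_mul h1 (mul_le_mul_of_nonneg_left h2 (Real.rpow_nonneg hr0.le _)) (by positivity) hT0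
  -- swap the sums and bound the multiples of each `g ∣ N`
  have hg : ∀ g ∈ N.divisors,
      ∑ r ∈ Icc (R + 1) R₂, ((r : ℝ)) ^ (-(101 / 100 : ℝ)) * (if g ∣ r then Real.sqrt (g : ℝ) else 0) ≤ Z := by
    intro g hgN
    have hg0 : g ≠ 0 := Nat.pos_iff_ne_zero.mp (Nat.pos_of_mem_divisors hgN)
    have hg1 : (1 : ℝ) ≤ g := by exact_mod_cast Nat.pos_of_ne_zero hg0
    have hgr : (0 : ℝ) < g := by linarith
    have hrw : ∑ r ∈ Icc (R + 1) R₂, ((r : ℝ)) ^ (-(101 / 100 : ℝ)) * (if g ∣ r then Real.sqrt (g : ℝ) else 0) =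
        (∑ r ∈ (Icc (R + 1) R₂).filter (fun r ↦ g ∣ r), ((r : ℝ)) ^ (-(101 / 100 : ℝ))) * Real.sqrt (g : ℝ) := by
      rw [Finset.sum_mul, Finset.sum_filter]
      refine Finset.sum_congr rfl fun r _ ↦ ?_
      split_ifs <;> simp
    rw [hrw]
    have hs := sum_filter_dvd_rpow_le hg0 R R₂
    have hsq : Real.sqrt (g : ℝ) * ((g : ℝ)) ^ (-(101 / 100 : ℝ)) ≤ 1 := by
      rw [Real.sqrt_eq_rpow, ← Real.rpow_add hgr]
      exact Real.rpow_le_one_of_one_le_of_nonpos hg1 (by norm_num)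
    calc (∑ r ∈ (Icc (R + 1) R₂).filter (fun r ↦ g ∣ r), ((r : ℝ)) ^ (-(101 / 100 : ℝ))) * Real.sqrt (g : ℝ)
        ≤ (((g : ℝ)) ^ (-(101 / 100 : ℝ)) * Z) * Real.sqrt (g : ℝ) :=
          mul_le_mul_of_nonneg_right hs (Real.sqrt_nonneg _)
      _ = (Real.sqrt (g : ℝ) * ((g : ℝ)) ^ (-(101 / 100 : ℝ))) * Z := by ring
      _ ≤ 1 * Z := mul_le_mul_of_nonneg_right hsq hZ0
      _ = Z := one_mul _
  have hswap : ∑ r ∈ Icc (R + 1) R₂, (((r : ℝ)) ^ (-(101 / 100 : ℝ)) *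
        ∑ g ∈ N.divisors, (if g ∣ r then Real.sqrt (g : ℝ) else 0)) =
      ∑ g ∈ N.divisors, ∑ r ∈ Icc (R + 1) R₂,
        ((r : ℝ)) ^ (-(101 / 100 : ℝ)) * (if g ∣ r then Real.sqrt (g : ℝ) else 0) := by
    rw [Finset.sum_comm]
    refine Finset.sum_congr rfl fun r _ ↦ ?_
    rw [Finset.mul_sum]
  calc ∑ r ∈ Icc (R + 1) R₂, ((r : ℝ)) ^ (-(149 / 100 : ℝ)) * Real.sqrt ((Nat.gcd N r : ℕ) : ℝ)
      ≤ ∑ r ∈ Icc (R + 1) R₂, T * (((r : ℝ)) ^ (-(101 / 100 : ℝ)) *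
          ∑ g ∈ N.divisors, (if g ∣ r then Real.sqrt (g : ℝ) else 0)) := Finset.sum_le_sum hpt
    _ = T * ∑ g ∈ N.divisors, ∑ r ∈ Icc (R + 1) R₂,
          ((r : ℝ)) ^ (-(101 / 100 : ℝ)) * (if g ∣ r then Real.sqrt (g : ℝ) else 0) := by
        rw [← Finset.mul_sum, hswap]
    _ ≤ T * ∑ g ∈ N.divisors, Z := mul_le_mul_of_nonneg_left (Finset.sum_le_sum hg) hT0
    _ = Z * (N.divisors.card : ℝ) * T := by rw [Finset.sum_const, nsmul_eq_mul]; ring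

/-! ## §4. The far-layer kernel sum at the pairs of the spectral sum -/


/-- **The far layers' kernel at a pair of the spectral sum, summed absolutely over `R < r ≤ R₂`.** For `q` prime, a divisor
bound `τ ≤ C (·)^{1/100}`, `1 ≤ m₁ < q`, `n₁ ≠ 0`, `d₁ ∣ (m₁, n₁)` and any `m₂, n₂, d₂`:
`Σ_{R < r ≤ R₂} ‖(2π/q) r⁻¹ S(a,b;qr) J₁(4π√(ab)/(qr))‖ ≤ 8π²Cζ · q^{−3/2} (R+1)^{−12/25} · √((n₁,q)) τ(m₁)τ(n₁) √(m₁n₁m₂n₂)`,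
`a = m₁n₁/d₁²`, `b = m₂n₂/d₂²`, `ζ = ζ_ℕ(101/100)` (Weil with the gcd split `(a,qr) ≤ (n₁,q)(m₁n₁,r)`, the gcd sum, and
`τ(m₁n₁) ≤ τ(m₁)τ(n₁)`). [cite: Iwaniec2002, §2.5 (2.25); KowalskiMichel2000, §2.4.2 p. 312] -/
theorem sum_norm_layerKernel_le {q : ℕ} [NeZero q] (hq : q.Prime) {C : ℝ}
    (hC : ∀ r : ℕ, ((r.divisors.card : ℕ) : ℝ) ≤ C * (r : ℝ) ^ (1 / 100 : ℝ))
    {m₁ n₁ d₁ : ℕ} (m₂ n₂ d₂ : ℕ) (hm₁ : 1 ≤ m₁) (hm₁q : m₁ < q) (hn₁ : n₁ ≠ 0)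
    (hd₁ : d₁ ∈ (Nat.gcd m₁ n₁).divisors) (R R₂ : ℕ) :
    ∑ r ∈ Icc (R + 1) R₂, ‖layerKernel q r (m₁ * n₁ / d₁ ^ 2) (m₂ * n₂ / d₂ ^ 2)‖ ≤
      8 * π ^ 2 * C * (∑' k : ℕ, ((k : ℝ)) ^ (-(101 / 100 : ℝ))) *
        ((q : ℝ)) ^ (-(3 / 2 : ℝ)) * (((R + 1 : ℕ) : ℝ)) ^ (-(12 / 25 : ℝ)) *
        (Real.sqrt ((Nat.gcd n₁ q : ℕ) : ℝ) * ((m₁.divisors.card : ℕ) : ℝ) * ((n₁.divisors.card : ℕ) : ℝ) *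
          Real.sqrt (((m₁ : ℝ) * n₁) * ((m₂ : ℝ) * n₂))) := by
  set Z : ℝ := ∑' k : ℕ, ((k : ℝ)) ^ (-(101 / 100 : ℝ)) with hZ
  have hZ0 : 0 ≤ Z := tsum_nonneg fun k ↦ Real.rpow_nonneg (Nat.cast_nonneg _) _
  have hq0 : (0 : ℝ) < q := by exact_mod_cast hq.pos
  have hC0 : 0 ≤ C := by
    have h := hC 1
    simp at h
    linarith
  have hqm : ¬ q ∣ m₁ := fun h ↦ absurd (Nat.le_of_dvd (by omega) h) (by omega)
  have hN0 : m₁ * n₁ ≠ 0 := mul_ne_zero (by omega) hn₁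
  set a : ℕ := m₁ * n₁ / d₁ ^ 2 with ha
  set b : ℕ := m₂ * n₂ / d₂ ^ 2 with hb
  -- sizes of the pair
  have hab : Real.sqrt ((a : ℝ) * b) ≤ Real.sqrt (((m₁ : ℝ) * n₁) * ((m₂ : ℝ) * n₂)) := by
    refine Real.sqrt_le_sqrt ?_
    have h1 : (a : ℝ) ≤ (m₁ : ℝ) * n₁ := by rw [ha]; exact_mod_cast Nat.div_le_self _ _
    have h2 : (b : ℝ) ≤ (m₂ : ℝ) * n₂ := by rw [hb]; exact_mod_cast Nat.div_le_self _ _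
    exact mul_le_mul h1 h2 (Nat.cast_nonneg _) (by positivity)
  -- the norm of `2π/q`
  have hn2π : ‖(2 * (π : ℂ) / (q : ℂ))‖ = 2 * π / q := by
    rw [norm_div, norm_mul, Complex.norm_ofNat, Complex.norm_real, Complex.norm_natCast, Real.norm_eq_abs,
      abs_of_pos Real.pi_pos]
  set c₁ : ℝ := (2 * π / q) * (4 * π * C * (q : ℝ) ^ (-(1 / 2 : ℝ)) * Real.sqrt ((Nat.gcd n₁ q : ℕ) : ℝ) *
        Real.sqrt (((m₁ : ℝ) * n₁) * ((m₂ : ℝ) * n₂))) with hc₁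
  have hc₁0 : 0 ≤ c₁ := by positivity
  -- termwise bound
  have hterm : ∀ r ∈ Icc (R + 1) R₂, ‖layerKernel q r a b‖ ≤
      c₁ * (((r : ℝ)) ^ (-(149 / 100 : ℝ)) * Real.sqrt ((Nat.gcd (m₁ * n₁) r : ℕ) : ℝ)) := by
    intro r hr
    have hr0 : r ≠ 0 := by have := (Finset.mem_Icc.mp hr).1; omega
    have hK := norm_petKloostermanTerm_le_gcd_rpow hq a b (ε := 1 / 100) hC r hr0
    have e : (-(3 / 2 - 1 / 100 : ℝ)) = -(149 / 100 : ℝ) := by norm_num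
    rw [e] at hK
    -- the gcd split
    have hg : Real.sqrt ((Nat.gcd a (q * r) : ℕ) : ℝ) ≤
        Real.sqrt ((Nat.gcd n₁ q : ℕ) : ℝ) * Real.sqrt ((Nat.gcd (m₁ * n₁) r : ℕ) : ℝ) := by
      rw [← Real.sqrt_mul (Nat.cast_nonneg _)]
      refine Real.sqrt_le_sqrt ?_
      exact_mod_cast gcd_mul_div_sq_le hq hqm hn₁ hr0 hd₁
    have hpet : ‖KowalskiMichel2000.petKloostermanTerm q a b r‖ ≤
        (4 * π * C * (q : ℝ) ^ (-(1 / 2 : ℝ)) * Real.sqrt ((Nat.gcd n₁ q : ℕ) : ℝ) *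
          Real.sqrt (((m₁ : ℝ) * n₁) * ((m₂ : ℝ) * n₂))) *
        (((r : ℝ)) ^ (-(149 / 100 : ℝ)) * Real.sqrt ((Nat.gcd (m₁ * n₁) r : ℕ) : ℝ)) := by
      calc ‖KowalskiMichel2000.petKloostermanTerm q a b r‖
          ≤ 4 * π * C * Real.sqrt ((Nat.gcd a (q * r) : ℕ) : ℝ) * Real.sqrt ((a : ℝ) * b) *
            (q : ℝ) ^ (-(1 / 2 : ℝ)) * (r : ℝ) ^ (-(149 / 100 : ℝ)) := hK
        _ ≤ 4 * π * C * (Real.sqrt ((Nat.gcd n₁ q : ℕ) : ℝ) * Real.sqrt ((Nat.gcd (m₁ * n₁) r : ℕ) : ℝ)) *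
            Real.sqrt (((m₁ : ℝ) * n₁) * ((m₂ : ℝ) * n₂)) * (q : ℝ) ^ (-(1 / 2 : ℝ)) * (r : ℝ) ^ (-(149 / 100 : ℝ)) := by
          gcongr
        _ = _ := by ring
    unfold layerKernel
    rw [norm_mul, hn2π]
    calc 2 * π / q * ‖KowalskiMichel2000.petKloostermanTerm q a b r‖
        ≤ 2 * π / q * ((4 * π * C * (q : ℝ) ^ (-(1 / 2 : ℝ)) * Real.sqrt ((Nat.gcd n₁ q : ℕ) : ℝ) *
            Real.sqrt (((m₁ : ℝ) * n₁) * ((m₂ : ℝ) * n₂))) *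
          (((r : ℝ)) ^ (-(149 / 100 : ℝ)) * Real.sqrt ((Nat.gcd (m₁ * n₁) r : ℕ) : ℝ))) :=
          mul_le_mul_of_nonneg_left hpet (by positivity)
      _ = _ := by rw [hc₁]; ring
  -- sum over the layers with the gcd sum
  have hgs := sum_rpow_sqrt_gcd_le hN0 R R₂
  have hτ : (((m₁ * n₁).divisors.card : ℕ) : ℝ) ≤ ((m₁.divisors.card : ℕ) : ℝ) * ((n₁.divisors.card : ℕ) : ℝ) := by
    exact_mod_cast Literature.NumberTheory.Sieve.DFI1995.card_divisors_mul_le m₁ n₁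
  have hT0 : 0 ≤ (((R + 1 : ℕ) : ℝ)) ^ (-(12 / 25 : ℝ)) := Real.rpow_nonneg (Nat.cast_nonneg _) _
  have hq32 : (q : ℝ)⁻¹ * (q : ℝ) ^ (-(1 / 2 : ℝ)) = (q : ℝ) ^ (-(3 / 2 : ℝ)) := by
    rw [← Real.rpow_neg_one, ← Real.rpow_add hq0]; norm_num
  calc ∑ r ∈ Icc (R + 1) R₂, ‖layerKernel q r a b‖
      ≤ ∑ r ∈ Icc (R + 1) R₂, c₁ * (((r : ℝ)) ^ (-(149 / 100 : ℝ)) * Real.sqrt ((Nat.gcd (m₁ * n₁) r : ℕ) : ℝ)) :=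
        Finset.sum_le_sum hterm
    _ = c₁ * ∑ r ∈ Icc (R + 1) R₂, ((r : ℝ)) ^ (-(149 / 100 : ℝ)) * Real.sqrt ((Nat.gcd (m₁ * n₁) r : ℕ) : ℝ) := by
        rw [Finset.mul_sum]
    _ ≤ c₁ * (Z * (((m₁ * n₁).divisors.card : ℕ) : ℝ) * (((R + 1 : ℕ) : ℝ)) ^ (-(12 / 25 : ℝ))) :=
        mul_le_mul_of_nonneg_left hgs hc₁0
    _ ≤ c₁ * (Z * (((m₁.divisors.card : ℕ) : ℝ) * ((n₁.divisors.card : ℕ) : ℝ)) *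
          (((R + 1 : ℕ) : ℝ)) ^ (-(12 / 25 : ℝ))) :=
        mul_le_mul_of_nonneg_left (mul_le_mul_of_nonneg_right (mul_le_mul_of_nonneg_left hτ hZ0) hT0) hc₁0
    _ = 8 * π ^ 2 * C * Z * ((q : ℝ)⁻¹ * (q : ℝ) ^ (-(1 / 2 : ℝ))) * (((R + 1 : ℕ) : ℝ)) ^ (-(12 / 25 : ℝ)) *
          (Real.sqrt ((Nat.gcd n₁ q : ℕ) : ℝ) * ((m₁.divisors.card : ℕ) : ℝ) * ((n₁.divisors.card : ℕ) : ℝ) *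
            Real.sqrt (((m₁ : ℝ) * n₁) * ((m₂ : ℝ) * n₂))) := by
        rw [hc₁, div_eq_mul_inv]; ring
    _ = _ := by rw [hq32]

end Summit.Parity.GeneralizedHardyLittlewood.Theorems.MomentsBeyondDiagonal.FarLayers

end
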